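import Literature.Barriers.AtomisticToContinuum.AnticontinuumLocalizationThm1Gibbs
import Literature.Barriers.AtomisticToContinuum.AnticontinuumLocalizationDecorrelation
import HarnessLib

/-!
# De Roeck–Huveneers 2015: Theorem 1 for the chain from window solutions

`Literature/Barriers/AtomisticToContinuum/` — the reduction "window solutions for all finite windows
⟹ `DeRoeckHuveneers2015_thm1`" (W. De Roeck, F. Huveneers, CPAM 68 (2015), arXiv:1305.5127,
Theorem 1 for the rotor chain; `IsWindowSolution` of `AnticontinuumLocalizationThm1Window.lean`),
and its corollaries for the barrier (Theorem 2) and for Theorem 4. The hypothesis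
`WindowSolutionsExist`-shaped statement is spelled out in the theorems (no named fact is introduced):
for `γ ≥ 0`, `T > 0`, `n ≥ 1` there is a radius `M` such that every window `(m, b)` has constants
`C, ε₀ > 0` with window solutions for all `0 < ε < ε₀` — exactly what §§3–5 of the paper construct.

Proof (§5.2–5.3 of the paper made explicit for the lifted chain): fix `γ, T, n`, take the radius
`M` of the hypothesis and uniform constants `C, ε₀` over the finitely many window shapes
(`m ≤ 2M + 3`, `b < m`; `windowSolutions_uniform`). Given `ε < ε₀`, any `N` and a
bond `(a, a+1)`, let `S` be the window of half-width `M + 1` around `a`, `π` the restriction to `S`,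
and `U, G` the window objects; put `U_a = U ∘ π - ⟨U ∘ π⟩_T`, `G_a = G ∘ π`. Then
`L_{H_N} U_a = (L_{H_S} U) ∘ π` (`liouville_comp_windowProj`, the cut edges of `S` are at distance
`M + 1 > M` from `b`), so `ε J_{a,a+1} = L_H U_a + ε^{n+1} G_a` on `Ω_N`; the `L²(⟨·⟩_T)` bounds are
the Gaussian moments of the `ω`-majorants (`sq_bound_of_window_majorant`, momentum marginal of the
product Gibbs state), subtracting the mean costs nothing (`integral_sq_sub_average_le`), and
`⟨G_a⟩_T = ε^{-n-1}(ε⟨J_{a,a+1}⟩_T - ⟨L_H U_a⟩_T) = 0` by `integral_bondCurrent` and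
`integral_liouville_eq_zero` ("by invariance of the Gibbs state").

* `DeRoeckHuveneers2015_thm1_of_windowSolutions : (∀ γ ≥ 0, ∀ T > 0, ∀ n ≥ 1, ∃ M, ∀ m b, ∃ C ε₀ > 0,
    ∀ ε ∈ (0, ε₀), ∃ U G, IsWindowSolution m b γ T ε n M C U G) → DeRoeckHuveneers2015_thm1`
* `DeRoeckHuveneers2015_thm2_of_windowSolutions`, `DeRoeckHuveneers2015_thm4_of_windowSolutions`.

All proved, theorem-only. [cite: DeRoeckHuveneers2015, §5.2–5.3 and §2.3 Thm 1]
-/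

noncomputable section

open MeasureTheory ProbabilityTheory Function Set Filter
open scoped ENNReal NNReal ContDiff Topology

namespace Literature.Barriers.AtomisticToContinuum

open Literature.MathematicalPhysics.KineticTheory.HeatConduction HeatConduction HeatConduction.RotorChain

/-! ### Uniform constants over the finitely many window shapes -/

/-- Window solutions for all windows, with constants `C ≥ M`, `C ≥ 0`, `ε₀ > 0` made uniform over
all windows of at most `2M + 3` sites (a finite maximum / minimum). [cite: DeRoeckHuveneers2015, §5] -/
theorem HeatConduction.RotorChain.windowSolutions_uniform {γ T : ℝ} {n : ℕ}
    (h : ∃ M : ℕ, ∀ (m : ℕ) (b : Fin m), ∃ C ε₀ : ℝ, 0 < ε₀ ∧ ∀ ε : ℝ, 0 < ε → ε < ε₀ →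
      ∃ U G : PhaseSpace m → ℝ, IsWindowSolution m b γ T ε n M C U G) :
    ∃ M : ℕ, ∃ C ε₀ : ℝ, 0 ≤ C ∧ (M : ℝ) ≤ C ∧ 0 < ε₀ ∧
      ∀ m : ℕ, m ≤ 2 * M + 3 → ∀ b : Fin m, ∀ ε : ℝ, 0 < ε → ε < ε₀ →
        ∃ U G : PhaseSpace m → ℝ, IsWindowSolution m b γ T ε n M C U G := by
  classical
  obtain ⟨M, hM⟩ := h
  choose Cf ε₀f hε₀f hmain using hM
  let S : Finset (Σ m : ℕ, Fin m) := (Finset.range (2 * M + 4)).sigma fun _ => Finset.univ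
  have hS : S.Nonempty := ⟨⟨1, 0⟩, by simp [S]⟩
  set Cs : ℝ := S.sup' hS fun p => Cf p.1 p.2 with hCs
  set εs : ℝ := S.inf' hS fun p => ε₀f p.1 p.2 with hεs
  refine ⟨M, max (max Cs 0) M, εs, le_trans (le_max_right _ _) (le_max_left _ _), le_max_right _ _,
    (Finset.lt_inf'_iff hS).2 fun p _ => hε₀f p.1 p.2, ?_⟩
  intro m hm b ε hε hεε
  have hp : (⟨m, b⟩ : Σ m : ℕ, Fin m) ∈ S := by
    simp only [S, Finset.mem_sigma, Finset.mem_range, Finset.mem_univ, and_true]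
    omega
  have hC : Cf m b ≤ max (max Cs 0) M :=
    le_trans (le_trans (Finset.le_sup' (fun p : Σ m : ℕ, Fin m => Cf p.1 p.2) hp) (le_max_left _ _))
      (le_max_left _ _)
  have hε₀ : εs ≤ ε₀f m b := Finset.inf'_le (fun p : Σ m : ℕ, Fin m => ε₀f p.1 p.2) hp
  obtain ⟨U, G, hUG⟩ := hmain m b ε hε (lt_of_lt_of_le hεε hε₀)
  exact ⟨U, G, hUG.mono hε.le hC⟩

/-! ### Integrability of the current -/

/-- The bond current is `⟨·⟩_T`-integrable (`|J_{a,a+1}| ≤ |ω_{a+1}|`, Gaussian momenta). [folklore] -/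
theorem HeatConduction.RotorChain.integrable_bondCurrent {N : ℕ} {T ε γ : ℝ} (hT : 0 < T)
    (hε : 0 ≤ ε) (hγ : 0 ≤ γ) (a : Fin N) : Integrable (bondCurrent N a) (gibbsMeasure N T ε γ) := by
  haveI := isProbabilityMeasure_configGibbs (N := N) (div_nonneg hε hT.le) hγ
  haveI := isProbabilityMeasure_gibbsMeasure hT N ε γ
  by_cases h : a.val + 1 < N
  · set a' : Fin N := ⟨a.val + 1, h⟩
    have hJ : bondCurrent N a = fun z => Real.sin (z.1 a - z.1 a') * z.2 a' := by
      funext z; rw [bondCurrent_eq_dite, dif_pos h]; ring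
    rw [hJ, gibbsMeasure_eq_prod hT hε hγ]
    refine Integrable.mul_prod (f := fun q : Fin N → ℝ => Real.sin (q a - q a'))
      (g := fun w : Fin N → ℝ => w a') ?_ ?_
    · exact Integrable.of_bound (by fun_prop : Continuous fun q : Fin N → ℝ =>
        Real.sin (q a - q a')).aestronglyMeasurable 1 (Eventually.of_forall fun q => by
          simpa using Real.abs_sin_le_one (q a - q a'))
    · refine integrable_eval (μ := fun _ : Fin N => gaussianReal 0 T.toNNReal) ?_
      have hm : MemLp id ((1 : ℝ≥0) : ℝ≥0∞) (gaussianReal 0 T.toNNReal) := memLp_id_gaussianReal 1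
      exact memLp_one_iff_integrable.1 (by simpa using hm)
  · have hJ : bondCurrent N a = fun _ => 0 := by
      funext z; rw [bondCurrent_eq_dite, dif_neg h]
    rw [hJ]
    exact integrable_const 0

/-! ### The reduction -/

/-- **Theorem 1 for the chain from window solutions**: if for `γ ≥ 0`, `T > 0`, `n ≥ 1` there is
a radius `M` such that every finite window `(m, b)` admits, for all small `ε > 0`, window solutions
`(U, G)` with some constant `C` (§§3–5 of the paper), then `DeRoeckHuveneers2015_thm1` holds (every
`N`, `N`-uniform constants). [cite: DeRoeckHuveneers2015, §2.3 Thm 1 and §5.2–5.3] -/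
theorem DeRoeckHuveneers2015_thm1_of_windowSolutions
    (h : ∀ γ : ℝ, 0 ≤ γ → ∀ T : ℝ, 0 < T → ∀ n : ℕ, 1 ≤ n →
      ∃ M : ℕ, ∀ (m : ℕ) (b : Fin m), ∃ C ε₀ : ℝ, 0 < ε₀ ∧ ∀ ε : ℝ, 0 < ε → ε < ε₀ →
        ∃ U G : PhaseSpace m → ℝ, IsWindowSolution m b γ T ε n M C U G) :
    DeRoeckHuveneers2015_thm1 := by
  intro γ hγ T hT n hn
  obtain ⟨M, C, ε₀, hC0, hMC, hε₀, hmain⟩ := windowSolutions_uniform (h γ hγ T hT n hn)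
  refine ⟨C, ε₀, hε₀, fun ε hε hεε N _hN a => ?_⟩
  -- the window around `a` and its objects
  obtain ⟨U, G, hUs, hGs, hUp, hGp, hUl, hGl, hid, ⟨u₀, hu₀m, hU0, hbu₀⟩, ⟨u₁, hu₁m, hU1, hbu₁⟩,
    ⟨g₀, hg₀m, hG0, hbg₀⟩, ⟨g₁, hg₁m, hG1, hbg₁⟩⟩ :=
    hmain (windowSize a M) (windowSize_le a M) (windowBond a M) ε hε hεε
  haveI := isProbabilityMeasure_gibbsMeasure hT N ε γ
  have hε4 : 0 ≤ C * ε ^ (1 / 4 : ℝ) := by positivity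
  have hε4' : 0 ≤ C * ε ^ (-(1 / 4) : ℝ) := by positivity
  -- the transplanted `U`
  set V : PhaseSpace N → ℝ := U ∘ windowProj a M with hV
  have hVs : ContDiff ℝ ∞ V := contDiff_comp_windowProj a M hUs
  have hVs1 : ContDiff ℝ 1 V := hVs.of_le (by exact_mod_cast le_top)
  have hVc : Continuous V := hVs.continuous
  have hVp : IsAnglePeriodic N V := isAnglePeriodic_comp_windowProj a M hUp
  have hVl : DependsOnlyNear N a M V := dependsOnlyNear_comp_windowProj a M hUl
  have hV2 := sq_bound_of_window_majorant hT hε.le hγ a M hVc.aestronglyMeasurable hu₀m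
    (fun z => hU0 (windowProj a M z)) hε4 hbu₀
  obtain ⟨hVi, hW2i, hWmean, hWle⟩ := integral_sq_sub_average_le hVc.aestronglyMeasurable hV2.1
  set c : ℝ := ∫ w, V w ∂(gibbsMeasure N T ε γ) with hc
  -- the transplanted `G`
  set GN : PhaseSpace N → ℝ := G ∘ windowProj a M with hGN
  have hGNs : ContDiff ℝ ∞ GN := contDiff_comp_windowProj a M hGs
  have hGNs1 : ContDiff ℝ 1 GN := hGNs.of_le (by exact_mod_cast le_top)
  have hGNc : Continuous GN := hGNs.continuous
  have hGN2 := sq_bound_of_window_majorant hT hε.le hγ a M hGNc.aestronglyMeasurable hg₀m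
    (fun z => hG0 (windowProj a M z)) hC0 hbg₀
  obtain ⟨hGNi, -, -, -⟩ := integral_sq_sub_average_le hGNc.aestronglyMeasurable hGN2.1
  -- majorants of the coordinate derivatives of the transplants
  have hderQ : ∀ (F : PhaseSpace (windowSize a M) → ℝ) (u : (Fin (windowSize a M) → ℝ) → ℝ≥0∞),
      (∀ (w : PhaseSpace (windowSize a M)) (i : Fin (windowSize a M)), ‖partialQ i F w‖ₑ ≤ u w.2) →
      ∀ (x : Fin N) (z : PhaseSpace N),
        ‖partialQ x (F ∘ windowProj a M) z‖ₑ ≤ u (windowProj a M z).2 := by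
    intro F u hu x z
    by_cases hx : ∃ i, windowEmb a M i = x
    · obtain ⟨i, rfl⟩ := hx
      rw [partialQ_comp_windowProj]
      exact hu _ i
    · push Not at hx
      rw [partialQ_comp_windowProj_eq_zero a M F z hx]
      simp
  have hderP : ∀ (F : PhaseSpace (windowSize a M) → ℝ) (u : (Fin (windowSize a M) → ℝ) → ℝ≥0∞),
      (∀ (w : PhaseSpace (windowSize a M)) (i : Fin (windowSize a M)), ‖partialP i F w‖ₑ ≤ u w.2) →
      ∀ (x : Fin N) (z : PhaseSpace N),
        ‖partialP x (F ∘ windowProj a M) z‖ₑ ≤ u (windowProj a M z).2 := by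
    intro F u hu x z
    by_cases hx : ∃ i, windowEmb a M i = x
    · obtain ⟨i, rfl⟩ := hx
      rw [partialP_comp_windowProj]
      exact hu _ i
    · push Not at hx
      rw [partialP_comp_windowProj_eq_zero a M F z hx]
      simp
  -- the identity on the chain
  have hidN : ∀ z : PhaseSpace N,
      ε * bondCurrent N a z = liouville N ε γ (fun w => V w - c) z + ε ^ (n + 1) * GN z := by
    intro z
    rw [liouville_sub_const, hV, liouville_comp_windowProj a M hUl, bondCurrent_windowEmb a M z, hGN,
      comp_apply]
    exact hid (windowProj a M z)
  -- `⟨G_a⟩_T = 0`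
  have hJi := integrable_bondCurrent (N := N) hT hε.le hγ a
  have hUNi : Integrable (fun w => V w - c) (gibbsMeasure N T ε γ) := hVi.sub (integrable_const c)
  have hLeq : liouville N ε γ (fun w => V w - c) =
      fun z => ε * bondCurrent N a z - ε ^ (n + 1) * GN z := by
    funext z; have := hidN z; linarith
  have hLi : Integrable (liouville N ε γ (fun w => V w - c)) (gibbsMeasure N T ε γ) := by
    rw [hLeq]; exact (hJi.const_mul ε).sub (hGNi.const_mul _)
  have hL0 := integral_liouville_eq_zero T ε γ (hVs1.sub contDiff_const) (hVp.sub_const c) hUNi hLi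
  have hGmean : ∫ z, GN z ∂(gibbsMeasure N T ε γ) = 0 := by
    rw [hLeq, integral_sub (hJi.const_mul ε) (hGNi.const_mul _), integral_const_mul, integral_const_mul,
      integral_bondCurrent hT hε.le hγ a, mul_zero, zero_sub, neg_eq_zero, mul_eq_zero] at hL0
    exact hL0.resolve_left (pow_ne_zero _ hε.ne')
  refine ⟨fun w => V w - c, GN, hVs.sub contDiff_const, hGNs, hVp.sub_const c,
    isAnglePeriodic_comp_windowProj a M hGp, (hVl.mono hMC).sub_const c,
    (dependsOnlyNear_comp_windowProj a M hGl).mono hMC, hUNi, hGNi, hWmean, hGmean, hidN, hW2i,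
    hWle.trans hV2.2, hGN2.1, hGN2.2, fun x => ?_⟩
  -- the eight derivative bounds at site `x`
  have hQU := sq_bound_of_window_majorant hT hε.le hγ a M
    (continuous_partialQ hVs1 one_ne_zero x).aestronglyMeasurable hu₁m
    (hderQ U u₁ (fun w i => (hU1 w i).1) x) hε4' hbu₁
  have hPU := sq_bound_of_window_majorant hT hε.le hγ a M
    (continuous_partialP hVs1 one_ne_zero x).aestronglyMeasurable hu₁m
    (hderP U u₁ (fun w i => (hU1 w i).2) x) hε4' hbu₁
  have hQG := sq_bound_of_window_majorant hT hε.le hγ a M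
    (continuous_partialQ hGNs1 one_ne_zero x).aestronglyMeasurable hg₁m
    (hderQ G g₁ (fun w i => (hG1 w i).1) x) hC0 hbg₁
  have hPG := sq_bound_of_window_majorant hT hε.le hγ a M
    (continuous_partialP hGNs1 one_ne_zero x).aestronglyMeasurable hg₁m
    (hderP G g₁ (fun w i => (hG1 w i).2) x) hC0 hbg₁
  simp only [partialQ_sub_const, partialP_sub_const]
  exact ⟨hQU.1, hQU.2, hPU.1, hPU.2, hQG.1, hQG.2, hPG.1, hPG.2⟩

/-- **The barrier from window solutions**: Theorem 2 of De Roeck–Huveneers for the rotor chain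
follows from window solutions for all windows (via `DeRoeckHuveneers2015_thm2_of_thm1_alone`, whose
other input, the decorrelation (7.1), is discharged in the tree). [cite: DeRoeckHuveneers2015, §2.3 Thm 2 and §7] -/
theorem DeRoeckHuveneers2015_thm2_of_windowSolutions
    (h : ∀ γ : ℝ, 0 ≤ γ → ∀ T : ℝ, 0 < T → ∀ n : ℕ, 1 ≤ n →
      ∃ M : ℕ, ∀ (m : ℕ) (b : Fin m), ∃ C ε₀ : ℝ, 0 < ε₀ ∧ ∀ ε : ℝ, 0 < ε → ε < ε₀ →
        ∃ U G : PhaseSpace m → ℝ, IsWindowSolution m b γ T ε n M C U G) :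
    DeRoeckHuveneers2015_thm2 :=
  DeRoeckHuveneers2015_thm2_of_thm1_alone (DeRoeckHuveneers2015_thm1_of_windowSolutions h)

/-- Theorem 4 (frozen interval energies) from window solutions. [cite: DeRoeckHuveneers2015, §2.3 Thm 4 and §7] -/
theorem DeRoeckHuveneers2015_thm4_of_windowSolutions
    (h : ∀ γ : ℝ, 0 ≤ γ → ∀ T : ℝ, 0 < T → ∀ n : ℕ, 1 ≤ n →
      ∃ M : ℕ, ∀ (m : ℕ) (b : Fin m), ∃ C ε₀ : ℝ, 0 < ε₀ ∧ ∀ ε : ℝ, 0 < ε → ε < ε₀ →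
        ∃ U G : PhaseSpace m → ℝ, IsWindowSolution m b γ T ε n M C U G) :
    DeRoeckHuveneers2015_thm4 :=
  DeRoeckHuveneers2015_thm4_of_thm1 (DeRoeckHuveneers2015_thm1_of_windowSolutions h)

end Literature.Barriers.AtomisticToContinuum

end
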